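import Summits.ValiantsHypothesis.ValiantsHypothesis.Theorems.KPlusLogSqLawStaticTridiagonalDefs

/-!
# Route «KPlusLogSqLaw» — the bandwidth-one permutation of a path matching (definitions)

HONEST FRAMING.  Definitions file (D-0009: reviewed/audited) for step (T4) of the transfer of the kernel static-path `O(n log n)` law to
dominant chains of STATIC TRIDIAGONAL designs (seat val-sym-lift-p3 g6, 2026-08-27; helper line toward `WeakLifting`, item
`stmt-ValiantsHypothesis-19561`, witness-plan stub `stub_tridiagonalSectorB`).  Given a set `S` of items of the path `1, …, m-1` (item `t` = the
adjacent transposition of columns `t-1, t`), `swapFunN S` is the corresponding map on `ℕ` (`c ↦ c+1` if `c+1 ∈ S`, `c ↦ c-1` if `c ∈ S`,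
else `c`) and `classOf cls σ` the class map read off a class table.  No `Prop` is asserted; nothing here bears on `WeakLifting`, `TropicalB`,
`KPlusLogSqLaw`, `MatrixDescartes` (stmt-ValiantsHypothesis-18050) or `VP ≠ VNP`.

[folklore] (matchings of a path as involutions).
-/

set_option linter.dupNamespace false
set_option autoImplicit false

namespace Summit.ValiantsHypothesis.ValiantsHypothesis.Theorems.KPlusLogSqLaw

namespace StaticTridiagonal

open Finset Classical

noncomputable section

variable {m K : ℕ}

/-- the map on `ℕ` of the product of the adjacent transpositions `(t-1, t)`, `t ∈ S`. [folklore] -/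
def swapFunN (S : Finset ℕ) (c : ℕ) : ℕ := if c + 1 ∈ S then c + 1 else if c ∈ S then c - 1 else c

/-- the class map of a permutation read off a class table: column `c` carries the class of the entry `(σ c, c)`. [folklore] -/
def classOf (cls : Fin m → Fin m → Fin K) (σ : Equiv.Perm (Fin m)) : Fin m → Fin K := fun c => cls (σ c) c

end

end StaticTridiagonal

end Summit.ValiantsHypothesis.ValiantsHypothesis.Theorems.KPlusLogSqLaw
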